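import Summits.BirchSwinnertonDyer.Rank1Residual.GaloisImage.KolyvaginLevelOneUnitCaseOfFacts
import Literature.NumberTheory.EllipticCurves.NonEisensteinPrimeOfSurjective
import Literature.NumberTheory.EllipticCurves.Rank1Residual.PrintShape
import Literature.NumberTheory.EllipticCurves.Rank1Residual.PeriodUnitProofs
import HarnessLib

/-!
# The EXOTIC unit case with `#Ш_an` a CONCLUSION: `[0]⁺` a `3`-adic unit and `3 ∤ ∏ c_ℓ` give
# `BSD(E,3)` and `ord₃ #Ш(E)_an = 0`, with NO hypothesis on `#Ш_an` and NO Gross–Zagier–Kolyvagin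
# (cell `b2b-bsdres`, team n1011, row T-a5x-II (II.5); seat p13)

HONEST FRAMING (cell `b2b-bsdres`, run/shared/lean/b2b/bsd-rank1-residual/, verbatim in every
file): the goal of the cell is to DELETE the COMBINATION-SHAPED residual classes of the
Birch–Swinnerton-Dyer formula for ALL analytic-rank `≤ 1` elliptic curves over `ℚ` — "full BSD
formula for every rank `≤ 1` curve in class `C`" assembled STRICTLY from published theorems — so
that the rank-`≤ 1` remainder becomes exactly the CONSTRUCTION-SHAPED classes, which are TYPED
(missing-input `Prop`s), NOT attempted. This is not "finishing BSD". Team n1011 (N10/N11, the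
additive block `X4 ∧ p = 3`): research route; no claim beyond the stated classes; the label X4 and
the mark of RESIDUAL-MAP §I N11 are UNCHANGED by this file; nothing is booked. Theorems only: no
definition, no named fact; EXOTIC rows stay REDUCED (to the PORT DICT3₁ + named facts), none closed.

## What and why

p271070 / `KolyvaginLevelOneUnitCaseOfFacts` (II.2) take the row condition "`3 ∤ #Ш(E)_an`" in the
form `shaAn W = q ∧ padicValRat 3 q = 0` — a hypothesis about the ANALYTIC order of `Ш`, whose very
evaluation presupposes the rank (through the regulator).  On the unit rows this is redundant: once
the level-one certificate has produced `#Sel^(3)(E/ℚ) = 1`, the rank is `0`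
(`mordellWeilRank_eq_zero_of_card_selmerGroup_eq_one`, II.2), `Reg(E/ℚ) = 1`
(`regulator_eq_one_of_rank_zero`), `L(E,1) = [0]⁺_f · Ω⁺_f` (`IsNewformOf.entireLFunction_one_eq`,
Manin–Drinfeld / MTT §I.8), `Ω(E) = u · Ω⁺_f` with `|u|₃ = 1` (the period-transfer binder), so
`#Ш(E)_an = [0]⁺ · #E(ℚ)_tors² / (u · ∏ c_ℓ)` is a rational number with
`ord₃ #Ш_an = ord₃ [0]⁺ + 2·ord₃ #E(ℚ)_tors − ord₃ u − ord₃ ∏ c_ℓ = 0 + 0 − 0 − ord₃ ∏ c_ℓ`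
(`[0]⁺` a `3`-adic unit is the certificate's own hypothesis `ratModP 3 [0]⁺ ≠ 0`; `E(ℚ)[3] = 0` from
surj(3), `padicValNat_torsionOrder_eq_zero_of_irreducible`).  Hence:

* `padicValRat_eq_zero_of_ratModP_ne_zero` — `ratModP p q ≠ 0 ⟹ ord_p q = 0` (any prime `p`).
* **`bsdp_three_and_shaAn_unit_of_dictionaryOne_of_tamagawa`** — II.2's `bsdp_three_of_dictionaryOne_of_facts`
  with the hypotheses `(hq : shaAn W = q) (hv : padicValRat 3 q = 0)` REPLACED by
  `(htam : ¬ 3 ∣ W.tamagawaProduct)`, and the CONCLUSION strengthened to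
  `BSDp W 3 ∧ ∃ q : ℚ, shaAn W = q ∧ padicValRat 3 q = 0`: on an additive `3 ∤ c₃`, surj(3),
  `E(ℚ₃)[3] = 0`, `r_an = 0` row with `3 ∤ ∏ c_ℓ` and `[0]⁺` a `3`-adic unit, DICT3₁ gives BSD(E,3)
  AND that `#Ш(E)_an` is a `3`-adic unit — every hypothesis is an a-priori invariant (reduction
  data, image, local torsion, Tamagawa numbers, the mod-`3` `L`-value `[0]⁺`), none presupposes the
  rank or `#Ш_an`.
* `exists_kolyvaginDatum_bsdp_three_of_dictionaryOne_of_tamagawa` — `S, τ, η, D, v₃` discharged.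

BINDERS OF RECORD (nothing hidden): named facts `hS24`, `hS24₂`, `hPT`, `hEP` · row conditions
`Addv W 3`, `¬3 ∣ c₃`, surj(3), `#E(ℚ₃)[3] = 1`, `r_an = 0`, `¬3 ∣ ∏ c_ℓ` · the instance
`[Finite E[3]]` · THE PORT DICT3₁ · `P`, `3 ∤ c_P`, the unit period transfer, `[0]⁺ ≠ 0 (mod 3)`.
Nothing booked; no mark / label changed; EXOTIC rows REDUCED, none closed.

References: B. Mazur, J. Tate, J. Teitelbaum, Invent. Math. 84 (1986) §I.8 [MazurTateTeitelbaum1986Invent];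
R. L. Miller, LMS JCM 14 (2011) Def. 1.1 [Miller2011LMS]; C.-H. Kim, AJM 148 (2026) Thm. 3.13
[Kim2022StructureSelmer]; R. Sakamoto, JTNB 36 (2024) Thm. 4.4 [Sakamoto2024].
-/

noncomputable section

open scoped Classical NumberField ContRepresentation
open Field NumberField IsDedekindDomain
open WeierstrassCurve Literature.NumberTheory.EllipticCurves Literature.NumberTheory.EllipticCurves.ModularForms
  Literature.NumberTheory.EllipticCurves.Rank1Residual
  Literature.NumberTheory.EllipticCurves.Rank1Residual.Typed
  Literature.NumberTheory.GaloisRepresentations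
  Literature.NumberTheory.GaloisRepresentations.DiscreteGaloisModule Literature.NumberTheory.GaloisCohomology
open Literature.NumberTheory.DiophantineGeometry.Dioph (ratModP)

namespace Summit.BirchSwinnertonDyer.Rank1Residual.GaloisImage

/-- **`ratModP p q ≠ 0 ⟹ ord_p q = 0`**: `ratModP p q = num(q) · den(q)⁻¹` in `ℤ/p` is non-zero only
if `p ∤ num(q)` and `p ∤ den(q)`. [folklore] -/
theorem padicValRat_eq_zero_of_ratModP_ne_zero {p : ℕ} [hp : Fact p.Prime] {q : ℚ}
    (h : ratModP p q ≠ 0) : padicValRat p q = 0 := by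
  have hnum : ¬ (p : ℤ) ∣ q.num := by
    intro hd
    apply h
    rw [Literature.NumberTheory.DiophantineGeometry.Dioph.ratModP,
      (ZMod.intCast_zmod_eq_zero_iff_dvd q.num p).mpr hd, zero_mul]
  have hden : ¬ p ∣ q.den := by
    intro hd
    apply h
    rw [Literature.NumberTheory.DiophantineGeometry.Dioph.ratModP,
      (ZMod.natCast_eq_zero_iff q.den p).mpr hd, inv_zero, mul_zero]
  have hq0 : q ≠ 0 := by
    rintro rfl
    exact hnum (by simp)
  rw [padicValRat, padicValInt, padicValNat.eq_zero_of_not_dvd hden,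
    padicValNat.eq_zero_of_not_dvd (fun hd => hnum (Int.natCast_dvd.mpr ?_))]
  · simp
  · simpa using hd

variable (W : WeierstrassCurve ℚ) [W.IsElliptic]

/-- **The EXOTIC unit case with `#Ш_an` a CONCLUSION.**  II.2's `bsdp_three_of_dictionaryOne_of_facts`
with `(hq : shaAn W = q) (hv : padicValRat 3 q = 0)` REPLACED by `htam : ¬ 3 ∣ ∏ c_ℓ` and the
conclusion STRENGTHENED to `BSD(E,3) ∧ ord₃ #Ш(E)_an = 0`.  Chain: DICT3₁ → Kato classes → certificate
(p266233) → `#Sel^(3) = 1` (p265535) → rank `0` and `Ш(3) = ⊥` (II.2, no GZK); then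
`#Ш_an = L(E,1)·#tors²/(Ω·∏c·Reg)` with `Reg = 1` (rank `0`), `L(E,1) = [0]⁺·Ω⁺_f`
(`IsNewformOf.entireLFunction_one_eq`), `Ω = u·Ω⁺_f`: `#Ш_an = [0]⁺·#tors²/(u·∏c) ∈ ℚ`, and
`ord₃ = 0` from `ratModP 3 [0]⁺ ≠ 0`, `|u|₃ = 1`, `E(ℚ)[3] = 0` (surj(3)), `3 ∤ ∏c`.  Every
hypothesis is an a-priori invariant of the row; nothing presupposes the rank or `#Ш_an`.  NO tower,
NO (im), NO GZK.  EXOTIC rows REDUCED (to DICT3₁ + `hS24`, `hS24₂`, `hPT`, `hEP`), none closed;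
nothing booked; no mark / label changed.
[cite: Kim2022StructureSelmer, Thm. 3.13] [cite: Sakamoto2024, Thm. 4.4 (p. 926)]
[cite: MazurTateTeitelbaum1986Invent, §I.8 (8.6)] [cite: Miller2011LMS, §1 and Def. 1.1] -/
theorem bsdp_three_and_shaAn_unit_of_dictionaryOne_of_tamagawa [W.IsGloballyMinimal]
    (hS24 : Sakamoto2024.kolyvaginSystems_freeRankOne_zmod_three_pow)
    (hS24₂ : Sakamoto2024.kolyvaginSystems_idealOfBasis_eq_fittingIdeal_zmod_three_pow)
    (hPT : poitouTate_selmerStructure_duality ℚ)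
    (hEP : ∀ v : HeightOneSpectrum (𝓞 ℚ), localEulerPoincareCharacteristic (v.adicCompletion ℚ))
    [Finite (geomTorsion W ((3 : ℕ) : ℤ))]
    (hX : Addv W 3) (hc3 : ¬ 3 ∣ (W.baseChange ℚ_[3]).localTamagawaNumber ℤ_[3])
    (h3 : W.HasSurjectiveModNGaloisRep ((3 : ℕ) : ℤ)) (hr : W.analyticRank = 0)
    (ht : Nat.card {Q : (W.baseChange ℚ_[3]).toAffine.Point // (3 : ℕ) • Q = 0} = 1)
    (htam : ¬ 3 ∣ W.tamagawaProduct)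
    (τ : absoluteGaloisGroup ℚ) (hτμ : τ ∈ rootsOfUnityFixer ℚ 3)
    (hτq : Nonempty (cokerSubOne (W.torsionGaloisModule ((3 : ℕ) : ℤ)) τ ≃+ ZMod 3))
    (S : Finset (Place ℚ)) (hS : ∀ w : InfinitePlace ℚ, (Sum.inl w : Place ℚ) ∈ S)
    (h3S : ∀ v : HeightOneSpectrum (𝓞 ℚ), ((3 : ℕ) : 𝓞 ℚ) ∈ v.asIdeal → (Sum.inr v : Place ℚ) ∈ S)
    (hbadS : ∀ v : HeightOneSpectrum (𝓞 ℚ), ¬ W.HasGoodReductionAt v → (Sum.inr v : Place ℚ) ∈ S)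
    (D : KolyvaginDatum (W.torsionGaloisModule ((3 : ℕ) : ℤ)))
    (η : (q : HeightOneSpectrum (𝓞 ℚ)) → (ZMod (Ideal.absNorm q.asIdeal))ˣ)
    (hP : D.primes = frobeniusClassPrimes (W.torsionGaloisModule ((3 : ℕ) : ℤ))
      {v | (Sum.inr v : Place ℚ) ∈ S} τ 3)
    (hT : D.transverse = cyclotomicTransverse (W.torsionGaloisModule ((3 : ℕ) : ℤ)))
    (hD : D.HasCanonicalComparison 3 η)
    (v₃ : HeightOneSpectrum (𝓞 ℚ)) (hv₃ : ((3 : ℕ) : 𝓞 ℚ) ∈ v₃.asIdeal)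
    (hDict : KatoKuriharaDictionaryThreeOneAt W 0 D v₃)
    {N : ℕ} [NeZero N] (P : ModularParametrizationData W N)
    (hManin : ¬ ((3 : ℕ) : ℤ) ∣ P.maninConstant)
    (hΩ : ∃ u : ℚ, ‖(u : ℚ_[3])‖ = 1 ∧ W.realPeriodRat = u * plusPeriod P.f)
    (hunit : ratModP 3 (ratPlusSymbol P.f 0) ≠ 0) :
    BSDp W 3 ∧ ∃ q : ℚ, shaAn W = (q : ℂ) ∧ padicValRat 3 q = 0 := by
  haveI : Fact (Nat.Prime 3) := ⟨Nat.prime_three⟩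
  -- the Poitou–Tate family, the Kato classes, the certificate, `#Sel^(3) = 1`
  obtain ⟨inv, hperf, hsum, hunro, hcompl⟩ := hPT 3
  obtain ⟨κ₀, Λ, -, ⟨κ', hI4⟩, -, hΛker, hdict⟩ :=
    hDict hX hc3 h3 (by rw [ht, pow_zero]) hv₃ P hManin hΩ
  obtain ⟨w, ψ, -, hval⟩ := hdict ∅ D.isLevel_empty
  rw [kuriharaNumber_eq_ratModP_of_eq_one P.f 3 _ _ Finset.prod_empty ψ] at hval
  have hcert := apply_empty_not_mem_selmerGroup_kummer_of_dictionary W v₃ κ₀ κ' hI4 Λ hΛker hval rfl hunit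
  have hsel : Nat.card (W.selmerGroup (3 : ℤ)) = 1 :=
    natCard_selmerGroup_three_eq_one_of_levelOne_certificate W hS24 hS24₂ h3 τ hτμ hτq inv hperf hsum
      hunro hcompl hEP S hS h3S hbadS D η hP hT hD κ' hcert
  -- rank `0`, hence `Reg = 1`
  have hr0 : W.mordellWeilRank = 0 :=
    mordellWeilRank_eq_zero_of_card_selmerGroup_eq_one W 3 (by exact_mod_cast hsel)
  have hReg : W.regulator = 1 := W.regulator_eq_one_of_rank_zero hr0
  -- `#Ш_an = [0]⁺ · #tors² / (u · ∏c)`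
  obtain ⟨u, hu, hΩu⟩ := hΩ
  have hu0 : u ≠ 0 := by
    rintro rfl
    rw [Rat.cast_zero, norm_zero] at hu
    exact zero_ne_one hu
  have hΩf : 0 < plusPeriod P.f :=
    IsNewform0.plusPeriod_pos_holds P.isNewformOf.1 P.isNewformOf.coeffField_eq_bot
  have hT : 0 < W.torsionOrder := W.torsionOrder_pos_holds
  have hc : 0 < W.tamagawaProduct := W.tamagawaProduct_pos'
  set q : ℚ := ratPlusSymbol P.f 0 * (W.torsionOrder : ℚ) ^ 2 / (u * (W.tamagawaProduct : ℚ)) with hqdef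
  have hsha : shaAn W = ((q : ℚ) : ℂ) := by
    rw [shaAn_def, W.leadingLCoeff_eq_of_analyticRank_eq_zero hr, P.isNewformOf.entireLFunction_one_eq,
      hReg, hΩu, hqdef]
    have hcC : ((W.tamagawaProduct : ℚ) : ℂ) ≠ 0 := by exact_mod_cast hc.ne'
    have huC : ((u : ℚ) : ℂ) ≠ 0 := by exact_mod_cast hu0
    have hΩfC : ((plusPeriod P.f : ℝ) : ℂ) ≠ 0 := by exact_mod_cast hΩf.ne'
    push_cast
    field_simp
  have hvq : padicValRat 3 q = 0 := by
    have h0 : padicValRat 3 (ratPlusSymbol P.f 0) = 0 := padicValRat_eq_zero_of_ratModP_ne_zero hunit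
    have hsym0 : ratPlusSymbol P.f 0 ≠ 0 := by
      intro h
      apply hunit
      rw [h, Literature.NumberTheory.DiophantineGeometry.Dioph.ratModP]
      simp
    have huval : padicValRat 3 u = 0 := padicValRat_eq_zero_of_norm_ratCast_eq_one hu
    have hT0 : (W.torsionOrder : ℚ) ≠ 0 := by exact_mod_cast hT.ne'
    have hc0 : (W.tamagawaProduct : ℚ) ≠ 0 := by exact_mod_cast hc.ne'
    have hirr : W.HasIrreducibleModPGaloisRep 3 :=
      hasIrreducibleModPGaloisRep_of_hasSurjectiveModNGaloisRep W 3 h3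
    have htors : padicValNat 3 W.torsionOrder = 0 := padicValNat_torsionOrder_eq_zero_of_irreducible W 3 hirr
    have htamv : padicValNat 3 W.tamagawaProduct = 0 := padicValNat.eq_zero_of_not_dvd htam
    rw [hqdef, padicValRat.div (mul_ne_zero hsym0 (pow_ne_zero 2 hT0)) (mul_ne_zero hu0 hc0),
      padicValRat.mul hsym0 (pow_ne_zero 2 hT0), padicValRat.pow, padicValRat.mul hu0 hc0, h0, huval,
      padicValRat.of_nat, padicValRat.of_nat, htors, htamv]
    simp
  exact ⟨bsdp_of_card_selmerGroup_eq_one_of_analyticRank_eq_zero W 3 hr hsha hvq (by exact_mod_cast hsel),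
    q, hsha, hvq⟩

/-- **The same with `S`, `τ`, `η`, `D`, `v₃` discharged existentially** — the EXOTIC unit case from
NAMED FACTS + A-PRIORI ROW INVARIANTS + THE PORT: on an additive `3 ∤ c₃`, surj(3), `E(ℚ₃)[3] = 0`,
`r_an = 0`, `3 ∤ ∏ c_ℓ` row of a globally minimal `W/ℚ` with a modular parametrisation `P`,
`3 ∤ c_P`, the unit period transfer and `[0]⁺` a `3`-adic unit, granted `hS24`, `hS24₂`, `hPT`, `hEP`,
there are `S, τ, η, D, v₃` such that DICT3₁ implies `BSD(E,3)` and `ord₃ #Ш(E)_an = 0`.  Nothing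
booked; EXOTIC rows REDUCED, none closed. [cite: Kim2022StructureSelmer, Thm. 3.13]
[cite: Sakamoto2024, Thm. 4.4 (p. 926)] [cite: Miller2011LMS, §1 and Def. 1.1] -/
theorem exists_kolyvaginDatum_bsdp_three_of_dictionaryOne_of_tamagawa [W.IsGloballyMinimal]
    (hS24 : Sakamoto2024.kolyvaginSystems_freeRankOne_zmod_three_pow)
    (hS24₂ : Sakamoto2024.kolyvaginSystems_idealOfBasis_eq_fittingIdeal_zmod_three_pow)
    (hPT : poitouTate_selmerStructure_duality ℚ)
    (hEP : ∀ v : HeightOneSpectrum (𝓞 ℚ), localEulerPoincareCharacteristic (v.adicCompletion ℚ))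
    [Finite (geomTorsion W ((3 : ℕ) : ℤ))]
    (hX : Addv W 3) (hc3 : ¬ 3 ∣ (W.baseChange ℚ_[3]).localTamagawaNumber ℤ_[3])
    (h3 : W.HasSurjectiveModNGaloisRep ((3 : ℕ) : ℤ)) (hr : W.analyticRank = 0)
    (ht : Nat.card {Q : (W.baseChange ℚ_[3]).toAffine.Point // (3 : ℕ) • Q = 0} = 1)
    (htam : ¬ 3 ∣ W.tamagawaProduct)
    {N : ℕ} [NeZero N] (P : ModularParametrizationData W N)
    (hManin : ¬ ((3 : ℕ) : ℤ) ∣ P.maninConstant)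
    (hΩ : ∃ u : ℚ, ‖(u : ℚ_[3])‖ = 1 ∧ W.realPeriodRat = u * plusPeriod P.f)
    (hunit : ratModP 3 (ratPlusSymbol P.f 0) ≠ 0) :
    ∃ (S : Finset (Place ℚ)) (τ : absoluteGaloisGroup ℚ)
      (η : (q : HeightOneSpectrum (𝓞 ℚ)) → (ZMod (Ideal.absNorm q.asIdeal))ˣ)
      (D : KolyvaginDatum (W.torsionGaloisModule ((3 : ℕ) : ℤ))) (v₃ : HeightOneSpectrum (𝓞 ℚ)),
      (∀ w : InfinitePlace ℚ, (Sum.inl w : Place ℚ) ∈ S) ∧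
      (∀ v : HeightOneSpectrum (𝓞 ℚ), ((3 : ℕ) : 𝓞 ℚ) ∈ v.asIdeal → (Sum.inr v : Place ℚ) ∈ S) ∧
      (∀ v : HeightOneSpectrum (𝓞 ℚ), ¬ W.HasGoodReductionAt v → (Sum.inr v : Place ℚ) ∈ S) ∧
      τ ∈ rootsOfUnityFixer ℚ 3 ∧
      Nonempty (cokerSubOne (W.torsionGaloisModule ((3 : ℕ) : ℤ)) τ ≃+ ZMod 3) ∧
      D.primes = frobeniusClassPrimes (W.torsionGaloisModule ((3 : ℕ) : ℤ))
        {v | (Sum.inr v : Place ℚ) ∈ S} τ 3 ∧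
      D.transverse = cyclotomicTransverse (W.torsionGaloisModule ((3 : ℕ) : ℤ)) ∧
      D.HasCanonicalComparison 3 η ∧ ((3 : ℕ) : 𝓞 ℚ) ∈ v₃.asIdeal ∧
      (KatoKuriharaDictionaryThreeOneAt W 0 D v₃ →
        BSDp W 3 ∧ ∃ q : ℚ, shaAn W = (q : ℂ) ∧ padicValRat 3 q = 0) := by
  haveI : Fact (Nat.Prime 3) := ⟨Nat.prime_three⟩
  obtain ⟨S, -, hS, h3S, hbadS⟩ := X11b.KummerPT.exists_exceptional_finset W 3 (∅ : Finset (Place ℚ))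
  obtain ⟨τ, hτ, hτq⟩ := exists_rootsOfUnityFixer_cokerSubOne_equiv_zmod_three_of_surj W h3
  have hτμ : τ ∈ rootsOfUnityFixer ℚ 3 := hτ 3 (by norm_num)
  obtain ⟨η, D, hP, hT, hD⟩ :=
    FSComp.exists_eta_kolyvaginDatum_hasCanonicalComparison_frobeniusClassPrimes
      (W.torsionGaloisModule ((3 : ℕ) : ℤ)) 3 {v | (Sum.inr v : Place ℚ) ∈ S} hτμ hτq
      (cyclotomicTransverse (W.torsionGaloisModule ((3 : ℕ) : ℤ)))
  let v₃ : HeightOneSpectrum (𝓞 ℚ) := (Rat.HeightOneSpectrum.primesEquiv (R := 𝓞 ℚ)).symm ⟨3, Nat.prime_three⟩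
  have hv₃ : ((3 : ℕ) : 𝓞 ℚ) ∈ v₃.asIdeal := three_mem_primesEquiv_symm_three
  exact ⟨S, τ, η, D, v₃, hS, h3S, hbadS, hτμ, hτq, hP, hT, hD, hv₃, fun hDict =>
    bsdp_three_and_shaAn_unit_of_dictionaryOne_of_tamagawa W hS24 hS24₂ hPT hEP hX hc3 h3 hr ht htam τ hτμ
      hτq S hS h3S hbadS D η hP hT hD v₃ hv₃ hDict P hManin hΩ hunit⟩

end Summit.BirchSwinnertonDyer.Rank1Residual.GaloisImage

end
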